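import Summits.CriticalPhenomena.PercolationContinuityZ3.Theorems.PercNearOneGluingNoHeavyLowerTailCertPositivity
import Summits.CriticalPhenomena.PercolationContinuityZ3.Theorems.PercNearOneGluingNoHeavyLowerTailCertProd
import HarnessLib

/-!
# `NoHeavyLowerTail` (stmt-CriticalPhenomena-4575) — certificate machine add-on: from an ORDERED certificate on open
# weights to the symmetric three-relay event gluing for all weights

Support file (new-inequality factory, all-graph proof seat `prim-ineq-prove-4`; `--supports stmt-CriticalPhenomena-4575`).
No definitions, no named facts, no sorries.

An LP certificate for the sharp three-relay event gluing EG₃ (this seat's `wf3sep` runs, checked by `…CertProd`) proves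
`μ({o↮b} ∩ {o↔A}) ≤ μ{a₁↮b}` only (i) under the worst-relay ORDER `μ{a₁↮b} ≥ μ{a₂↮b} ≥ μ{a₃↮b}` (its hypothesis rows)
and (ii) when its multiplier `M₀` is positive, which is guaranteed when all off-diagonal weights lie in `(0,1)`
(`CertCells.cell_pos`).  This file removes both provisos once and for all:
* `linEval_pos_of_cells`, `pM0val_pos_of_posSummand` — with weights in `(0,1)` and an injective placement, every
  nonempty list of consistent cells has positive mass, hence `M₀ > 0` as soon as one summand has positive weight and
  nonempty consistent factors (decidable test `posSummand`);
* `eg3Event`, `dist`, `relabel`, `eg3Event_relabel`, `relabel_injective` — the event `{o↮b} ∩ ({o↔a₁} ∪ {o↔a₂} ∪ {o↔a₃})` and its invariance under relabelling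
  the relays;
* `eg3_sym_of_ordered` — (ordered statement at fixed weights) ⇒ (`μ(E) ≤ max dᵢ` at the same weights), six cases;
* `eg3_all_of_open` — (symmetric statement for all weights in `(0,1)`) ⇒ (all weights), by the mixed weights `mixW`
  and the weight continuity `stub_weightContinuity` (pattern of `CertCells.Cert.exists_le_of_injective`);
* `eg3_of_ordered_open` — THE WRAPPER: ordered statement on open weights ⇒ `μ(E) ≤ t` whenever all three sink
  distances are `≤ t`, for every weighted graph and injective placement.
-/

noncomputable section

namespace Summit.CriticalPhenomena.PercolationContinuityZ3.Theorems

open MeasureTheory Set Filter Topology Literature.Probability.Percolation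
open Literature.Probability.LatticeModels (prodBernoulli)
open scoped Classical BigOperators
open PatternCells CertCheck CertCells

namespace EG3Wrap

variable {n : ℕ}

/-! ## Positivity of the multiplier at open weights -/

/-- With weights in `(0,1)` and an injective placement, a nonempty list of consistent cells has positive mass. [folklore] -/
theorem linEval_pos_of_cells (w : Sym2 (Fin n) → unitInterval)
    (hw : ∀ e : Sym2 (Fin n), ¬ e.IsDiag → 0 < ((w e : unitInterval) : ℝ) ∧ ((w e : unitInterval) : ℝ) < 1)
    {v : Fin 5 → Fin n} (hv : Function.Injective v) (e : List ℕ) (hne : e ≠ [])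
    (hcons : ∀ m ∈ e, m ∈ consPatterns) :
    0 < linEval (fun m => (prodBernoulli w).real (Cell v m)) e := by
  unfold linEval
  obtain ⟨m, e', rfl⟩ := List.exists_cons_of_ne_nil hne
  rw [List.map_cons, List.sum_cons]
  have h1 : 0 < (prodBernoulli w).real (Cell v m) := cell_pos w hw hv (hcons m (by simp))
  have h2 : 0 ≤ (e'.map fun m => (prodBernoulli w).real (Cell v m)).sum :=
    List.sum_nonneg (fun x hx => by
      obtain ⟨m', _, rfl⟩ := List.mem_map.1 hx
      exact measureReal_nonneg)
  linarith

/-- Decidable test: a summand of `M₀` with positive weight whose factors are nonempty lists of consistent cells. [folklore] -/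
def posSummand (M0 : List (List (List ℕ) × ℕ)) : Bool :=
  M0.any fun p => decide (0 < p.2) && p.1.all fun e => (!e.isEmpty) && e.all fun m => decide (m ∈ consPatterns)

/-- `M₀ > 0` at open weights and injective placements when `posSummand M0`. [folklore] -/
theorem pM0val_pos_of_posSummand (M0 : List (List (List ℕ) × ℕ)) (hM : posSummand M0 = true)
    (w : Sym2 (Fin n) → unitInterval)
    (hw : ∀ e : Sym2 (Fin n), ¬ e.IsDiag → 0 < ((w e : unitInterval) : ℝ) ∧ ((w e : unitInterval) : ℝ) < 1)
    {v : Fin 5 → Fin n} (hv : Function.Injective v) :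
    0 < pM0val (fun m => (prodBernoulli w).real (Cell v m)) M0 := by
  unfold posSummand at hM
  obtain ⟨p, hp, hpos⟩ := List.any_eq_true.1 hM
  simp only [Bool.and_eq_true, decide_eq_true_eq, List.all_eq_true, Bool.not_eq_true'] at hpos
  obtain ⟨hwt, hfac⟩ := hpos
  have hx : ∀ i, 0 ≤ (fun m => (prodBernoulli w).real (Cell v m)) i := fun i => measureReal_nonneg
  unfold pM0val
  have hterm : 0 < (p.2 : ℝ) * prodEval (fun m => (prodBernoulli w).real (Cell v m)) p.1 := by
    refine mul_pos (by exact_mod_cast hwt) ?_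
    unfold prodEval
    refine List.prod_pos fun y hy => ?_
    obtain ⟨e, he, rfl⟩ := List.mem_map.1 hy
    obtain ⟨hne, hcons⟩ := hfac e he
    refine linEval_pos_of_cells w hw hv e ?_ (fun m hm => hcons m hm)
    intro h
    rw [h] at hne
    simp at hne
  have hrest : ∀ q ∈ M0, 0 ≤ (q.2 : ℝ) * prodEval (fun m => (prodBernoulli w).real (Cell v m)) q.1 :=
    fun q _ => mul_nonneg (Nat.cast_nonneg _) (prodEval_nonneg _ hx _)
  calc (0 : ℝ) < (p.2 : ℝ) * prodEval (fun m => (prodBernoulli w).real (Cell v m)) p.1 := hterm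
    _ ≤ (M0.map fun q => (q.2 : ℝ) * prodEval (fun m => (prodBernoulli w).real (Cell v m)) q.1).sum :=
        List.single_le_sum (fun x hx => by
          obtain ⟨q, hq, rfl⟩ := List.mem_map.1 hx
          exact hrest q hq) _ (List.mem_map.2 ⟨p, hp, rfl⟩)

/-! ## The event and its symmetry -/

/-- The three-relay event-gluing event `{o↮b} ∩ ({o↔a₁} ∪ {o↔a₂} ∪ {o↔a₃})` for the placement `v`
(`0 = o`, `1,2,3 = relays`, `4 = b`). [folklore] -/
def eg3Event (v : Fin 5 → Fin n) : Set (BondConfig (Fin n)) :=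
  (openConn (v 0) (v 4) : Set (BondConfig (Fin n)))ᶜ ∩ (openConn (v 0) (v 1) ∪ openConn (v 0) (v 2) ∪ openConn (v 0) (v 3))

/-- The sink distance of relay `i`: `μ{v i ↮ v 4}`. [folklore] -/
def dist (w : Sym2 (Fin n) → unitInterval) (v : Fin 5 → Fin n) (i : Fin 5) : ℝ :=
  (prodBernoulli w).real (openConn (v i) (v 4) : Set (BondConfig (Fin n)))ᶜ

/-- Relabelled placement: relays in the order `(a, b, c)`. [folklore] -/
def relabel (v : Fin 5 → Fin n) (a b c : Fin 5) : Fin 5 → Fin n := ![v 0, v a, v b, v c, v 4]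

/-- The event is invariant under permuting the relays. [folklore] -/
theorem eg3Event_relabel (v : Fin 5 → Fin n) (a b c : Fin 5)
    (h : ({a, b, c} : Finset (Fin 5)) = {1, 2, 3}) : eg3Event (relabel v a b c) = eg3Event v := by
  have hmem : ∀ i : Fin 5, i ∈ ({a, b, c} : Finset (Fin 5)) ↔ i ∈ ({1, 2, 3} : Finset (Fin 5)) := fun i => by rw [h]
  ext ω
  simp only [eg3Event, relabel, Matrix.cons_val_zero, Matrix.cons_val_one, Matrix.head_cons,
    Matrix.cons_val_two, Matrix.tail_cons, Matrix.cons_val_three, Matrix.cons_val_four, Set.mem_inter_iff,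
    Set.mem_compl_iff, Set.mem_union, openConn, Set.mem_setOf_eq]
  constructor
  · rintro ⟨hb, hr⟩
    refine ⟨hb, ?_⟩
    have key : ∀ i : Fin 5, i ∈ ({a, b, c} : Finset (Fin 5)) → (openGraph ω).Reachable (v 0) (v i) →
        (openGraph ω).Reachable (v 0) (v 1) ∨ (openGraph ω).Reachable (v 0) (v 2) ∨ (openGraph ω).Reachable (v 0) (v 3) := by
      intro i hi hri
      have hi' := (hmem i).1 hi
      simp only [Finset.mem_insert, Finset.mem_singleton] at hi'
      rcases hi' with rfl | rfl | rfl
      · exact Or.inl hri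
      · exact Or.inr (Or.inl hri)
      · exact Or.inr (Or.inr hri)
    rcases hr with (ha | hb') | hc
    · rcases key a (by simp) ha with h1 | h2 | h3
      · exact Or.inl (Or.inl h1)
      · exact Or.inl (Or.inr h2)
      · exact Or.inr h3
    · rcases key b (by simp) hb' with h1 | h2 | h3
      · exact Or.inl (Or.inl h1)
      · exact Or.inl (Or.inr h2)
      · exact Or.inr h3
    · rcases key c (by simp) hc with h1 | h2 | h3
      · exact Or.inl (Or.inl h1)
      · exact Or.inl (Or.inr h2)
      · exact Or.inr h3
  · rintro ⟨hb, hr⟩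
    refine ⟨hb, ?_⟩
    have key : ∀ i : Fin 5, i ∈ ({1, 2, 3} : Finset (Fin 5)) → (openGraph ω).Reachable (v 0) (v i) →
        (openGraph ω).Reachable (v 0) (v a) ∨ (openGraph ω).Reachable (v 0) (v b) ∨ (openGraph ω).Reachable (v 0) (v c) := by
      intro i hi hri
      have hi' := (hmem i).2 hi
      simp only [Finset.mem_insert, Finset.mem_singleton] at hi'
      rcases hi' with rfl | rfl | rfl
      · exact Or.inl hri
      · exact Or.inr (Or.inl hri)
      · exact Or.inr (Or.inr hri)
    rcases hr with (h1 | h2) | h3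
    · rcases key 1 (by simp) h1 with h | h | h
      · exact Or.inl (Or.inl h)
      · exact Or.inl (Or.inr h)
      · exact Or.inr h
    · rcases key 2 (by simp) h2 with h | h | h
      · exact Or.inl (Or.inl h)
      · exact Or.inl (Or.inr h)
      · exact Or.inr h
    · rcases key 3 (by simp) h3 with h | h | h
      · exact Or.inl (Or.inl h)
      · exact Or.inl (Or.inr h)
      · exact Or.inr h

/-- The relabelled placement is `v ∘ σ` for the index map `σ = (0, a, b, c, 4)`. [folklore] -/
theorem relabel_eq_comp (v : Fin 5 → Fin n) (a b c : Fin 5) : relabel v a b c = v ∘ ![0, a, b, c, 4] := by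
  funext i
  fin_cases i <;> rfl

/-- Relabelling by an injective index map preserves injectivity. [folklore] -/
theorem relabel_injective {v : Fin 5 → Fin n} (hv : Function.Injective v) (a b c : Fin 5)
    (hσ : Function.Injective ![(0 : Fin 5), a, b, c, 4]) : Function.Injective (relabel v a b c) := by
  rw [relabel_eq_comp]
  exact hv.comp hσ

/-- Values of the relabelled placement. [folklore] -/
theorem relabel_apply (v : Fin 5 → Fin n) (a b c : Fin 5) :
    relabel v a b c 1 = v a ∧ relabel v a b c 2 = v b ∧ relabel v a b c 3 = v c ∧ relabel v a b c 4 = v 4 :=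
  ⟨rfl, rfl, rfl, rfl⟩

/-- Sink distances of the relabelled placement. [folklore] -/
theorem dist_relabel (w : Sym2 (Fin n) → unitInterval) (v : Fin 5 → Fin n) (a b c : Fin 5) :
    dist w (relabel v a b c) 1 = dist w v a ∧ dist w (relabel v a b c) 2 = dist w v b ∧
      dist w (relabel v a b c) 3 = dist w v c := by
  simp only [dist, (relabel_apply v a b c).1, (relabel_apply v a b c).2.1, (relabel_apply v a b c).2.2.1,
    (relabel_apply v a b c).2.2.2, and_self]

/-! ## From the ordered statement to the symmetric one -/

/-- **Ordered ⇒ symmetric** at fixed weights: `μ(E) ≤ max(d₁, d₂, d₃)`. [folklore] -/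
theorem eg3_sym_of_ordered (w : Sym2 (Fin n) → unitInterval)
    (H : ∀ v : Fin 5 → Fin n, Function.Injective v → dist w v 2 ≤ dist w v 1 → dist w v 3 ≤ dist w v 2 →
      (prodBernoulli w).real (eg3Event v) ≤ dist w v 1)
    (v : Fin 5 → Fin n) (hv : Function.Injective v) :
    (prodBernoulli w).real (eg3Event v) ≤ max (dist w v 1) (max (dist w v 2) (dist w v 3)) := by
  -- apply H to the relabelled placement with relays sorted
  have main : ∀ a b c : Fin 5, ({a, b, c} : Finset (Fin 5)) = {1, 2, 3} →
      Function.Injective ![(0 : Fin 5), a, b, c, 4] →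
      dist w v b ≤ dist w v a → dist w v c ≤ dist w v b →
      (prodBernoulli w).real (eg3Event v) ≤ dist w v a := by
    intro a b c habc hσ hba hcb
    have h := H (relabel v a b c) (relabel_injective hv a b c hσ)
    rw [eg3Event_relabel v a b c habc, (dist_relabel w v a b c).1, (dist_relabel w v a b c).2.1,
      (dist_relabel w v a b c).2.2] at h
    exact h hba hcb
  have e123 : ({1, 2, 3} : Finset (Fin 5)) = {1, 2, 3} := rfl
  have e132 : ({1, 3, 2} : Finset (Fin 5)) = {1, 2, 3} := by decide
  have e213 : ({2, 1, 3} : Finset (Fin 5)) = {1, 2, 3} := by decide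
  have e231 : ({2, 3, 1} : Finset (Fin 5)) = {1, 2, 3} := by decide
  have e312 : ({3, 1, 2} : Finset (Fin 5)) = {1, 2, 3} := by decide
  have e321 : ({3, 2, 1} : Finset (Fin 5)) = {1, 2, 3} := by decide
  have s123 : Function.Injective ![(0 : Fin 5), 1, 2, 3, 4] := by decide
  have s132 : Function.Injective ![(0 : Fin 5), 1, 3, 2, 4] := by decide
  have s213 : Function.Injective ![(0 : Fin 5), 2, 1, 3, 4] := by decide
  have s231 : Function.Injective ![(0 : Fin 5), 2, 3, 1, 4] := by decide
  have s312 : Function.Injective ![(0 : Fin 5), 3, 1, 2, 4] := by decide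
  have s321 : Function.Injective ![(0 : Fin 5), 3, 2, 1, 4] := by decide
  rcases le_total (dist w v 2) (dist w v 1) with h21 | h12 <;>
  rcases le_total (dist w v 3) (dist w v 2) with h32 | h23 <;>
  rcases le_total (dist w v 3) (dist w v 1) with h31 | h13
  · exact le_trans (main 1 2 3 e123 s123 h21 h32) (le_max_left _ _)
  · exact le_trans (main 1 2 3 e123 s123 h21 h32) (le_max_left _ _)
  · exact le_trans (main 1 3 2 e132 s132 h31 h23) (le_max_left _ _)
  · exact le_trans (main 3 1 2 e312 s312 h13 h21) (le_trans (le_max_right _ _) (le_max_right _ _))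
  · exact le_trans (main 2 1 3 e213 s213 h12 h31) (le_trans (le_max_left _ _) (le_max_right _ _))
  · exact le_trans (main 2 3 1 e231 s231 h32 h13) (le_trans (le_max_left _ _) (le_max_right _ _))
  · exact le_trans (main 3 2 1 e321 s321 h23 h12) (le_trans (le_max_right _ _) (le_max_right _ _))
  · exact le_trans (main 3 2 1 e321 s321 h23 h12) (le_trans (le_max_right _ _) (le_max_right _ _))

/-! ## From open weights to all weights -/

/-- **Open weights ⇒ all weights.**  If the symmetric statement `μ(E) ≤ max dᵢ` holds for every weight vector with
all off-diagonal weights in `(0,1)`, it holds for every weight vector (mixed weights + weight continuity). [folklore] -/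
theorem eg3_all_of_open
    (H : ∀ w : Sym2 (Fin n) → unitInterval,
      (∀ e : Sym2 (Fin n), ¬ e.IsDiag → 0 < ((w e : unitInterval) : ℝ) ∧ ((w e : unitInterval) : ℝ) < 1) →
      ∀ v : Fin 5 → Fin n, Function.Injective v →
        (prodBernoulli w).real (eg3Event v) ≤ max (dist w v 1) (max (dist w v 2) (dist w v 3)))
    (w : Sym2 (Fin n) → unitInterval) (v : Fin 5 → Fin n) (hv : Function.Injective v) :
    (prodBernoulli w).real (eg3Event v) ≤ max (dist w v 1) (max (dist w v 2) (dist w v 3)) := by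
  have hk : ∀ k, (prodBernoulli (mixW w k)).real (eg3Event v) ≤
      max (dist (mixW w k) v 1) (max (dist (mixW w k) v 2) (dist (mixW w k) v 3)) :=
    fun k => H (mixW w k) (fun e _ => mixW_pos_lt_one w k e) v hv
  have hE : Tendsto (fun k => (prodBernoulli (mixW w k)).real (eg3Event v)) atTop
      (𝓝 ((prodBernoulli w).real (eg3Event v))) :=
    ((stub_weightContinuity n _).tendsto w).comp (tendsto_mixW w)
  have hD : ∀ i : Fin 5, Tendsto (fun k => dist (mixW w k) v i) atTop (𝓝 (dist w v i)) :=
    fun i => ((stub_weightContinuity n _).tendsto w).comp (tendsto_mixW w)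
  have hM : Tendsto (fun k => max (dist (mixW w k) v 1) (max (dist (mixW w k) v 2) (dist (mixW w k) v 3))) atTop
      (𝓝 (max (dist w v 1) (max (dist w v 2) (dist w v 3)))) :=
    (hD 1).max ((hD 2).max (hD 3))
  exact le_of_tendsto_of_tendsto' hE hM hk

/-- **The wrapper.**  An ordered EG₃ statement valid for all open weight vectors gives the three-relay event gluing
with the sharp constant for every weighted graph, every injective placement and every bound `t` on the sink distances.
[folklore] -/
theorem eg3_of_ordered_open
    (H : ∀ w : Sym2 (Fin n) → unitInterval,
      (∀ e : Sym2 (Fin n), ¬ e.IsDiag → 0 < ((w e : unitInterval) : ℝ) ∧ ((w e : unitInterval) : ℝ) < 1) →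
      ∀ v : Fin 5 → Fin n, Function.Injective v → dist w v 2 ≤ dist w v 1 → dist w v 3 ≤ dist w v 2 →
        (prodBernoulli w).real (eg3Event v) ≤ dist w v 1)
    (w : Sym2 (Fin n) → unitInterval) (v : Fin 5 → Fin n) (hv : Function.Injective v) (t : ℝ)
    (h1 : dist w v 1 ≤ t) (h2 : dist w v 2 ≤ t) (h3 : dist w v 3 ≤ t) :
    (prodBernoulli w).real (eg3Event v) ≤ t := by
  have := eg3_all_of_open (fun w' hw' v' hv' => eg3_sym_of_ordered w' (H w' hw') v' hv') w v hv
  exact le_trans this (max_le h1 (max_le h2 h3))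

end EG3Wrap

end Summit.CriticalPhenomena.PercolationContinuityZ3.Theorems

end
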